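import Summits.QuantumAdvantage.QuantumAdvantage.Theses.ModularRank
import Literature.Computability.QuantumComplexity.StabilizerRankOver
import Literature.Computability.Complexity.PCPProofs

/-!
# Line `universal-identity-reduction` — item stmt-QuantumAdvantage-17857 (`ModularRank.DenseModularDecomposer`)

Skeleton registered by the crux-strategist (planner-cstrat-stmt-QuantumAdvantage-1792-r1-0,
2026-08-17; card `Lines/universal-identity-reduction.md`). The item is the ARITHMETIC piece of the
split `ModularRankPoly ⟸ DenseModularDecomposer ∧ DecomposerListingPolyTime`; it is HYPOTHESIS-TYPE
and CONSENSUS-FALSE (refuters first). This line is the one conceivable road TO it — "if it were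
true, this is how it would be proved" — and at the same time its sharpest KILL SURFACE: the
load-bearing stub is a `p`-free identity over the Clifford ring.

* `stub_uniformIntegralIdentity` (HYPOTHESIS-TYPE, consensus-false; the lever): a poly-time
  `G : 1ᵗ ↦ (m, [(Cᵢ, aᵢ)])` with `≤ t^c + c` T-free Clifford words `Cᵢ` and coefficients
  `aᵢ ∈ ℤ[ω]` (four integers) such that `2^m · (x ↦ ω^{|x|}) = Σ aᵢ(ω) · (Cᵢ e₀)` holds in EVERY
  commutative ring with a chosen `ω`, `ω⁴ = −1` — uniform polynomial INTEGRAL stabilizer rank of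
  the magic vector as a universal identity (equivalently: in `ℤ[X]/(X⁴+1)`; hence over `ℂ`, so
  `χ_ℂ(T^{⊗t}) ≤ t^c + c`: killed by `ExactRankSuperpoly` once `magicVectorOver ω t ∝ tensorPow
  magicT t` and integral stabilizer vectors `∝` stabilizer states are bridged — a provable support).
* `stub_reduceModP` (TRUE, M): from such a `G`, the per-prime decomposer `F t p = (r, L)` —
  search the least `r < p` with `r⁴ ≡ −1` (exists for `p ≡ 1 (mod 8)`: `(ZMod p)ˣ` cyclic of order
  divisible by `8`; poly-time in UNARY `p`), reduce the four integers and `2^{-m}` mod `p` (`p` odd) —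
  is poly-time on unary `(t,p)` and satisfies the identity at EVERY prime `p ≡ 1 (mod 8)`
  (specialise the universal identity to `R = ZMod p`, multiply by `(2⁻¹)^m`).
* `stub_primesOneModEightDense` (TRUE, M/L; quantitative Dirichlet, not in Mathlib): for some `d`,
  at least `k` primes `p ≡ 1 (mod 8)` lie below `(t+k)^d + d` (PNT in progressions; explicit:
  Bennett–Martin–O'Bryant–Rechnitzer 2018).
* `DenseModularDecomposer_of` — the composition, a REAL proof: recogniser `P := fun _ _ => true`
  (`PolyTimeComputable.const`), density from stub 3 (the filters agree pointwise), spec from stub 2.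
-/

set_option linter.dupNamespace false

namespace Summit.QuantumAdvantage.QuantumAdvantage.Cruxes.DenseModularDecomposer.UniversalIdentityReduction

open Summit.QuantumAdvantage.QuantumAdvantage.Theses.ModularRank

/-! ## Registered stubs -/

/-- **stub 1 (the lever; HYPOTHESIS-TYPE, consensus-false — refuters first, never delegate to
provers)**: uniform polynomial INTEGRAL stabilizer rank of the magic vector as a UNIVERSAL identity
over every commutative ring with `ω⁴ = −1` (coefficients in `ℤ[ω]` as four integers, one global
dyadic exponent `m`). Over `ℂ` it bounds `χ(T^{⊗t}) ≤ t^c + c` (conflicts with `ExactRankSuperpoly`,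
believed true; cf. MT24 Thm 1.6: then `P^#P ⊆ P/poly`). [cite: PelegShpilkaVolk2022, §2.1]
[cite: MehrabanTahmasbi2024, Thm 1.6] [cite: GilesSelinger2013, §3 Def. 1] -/
theorem stub_uniformIntegralIdentity :
    ∃ c : ℕ, ∃ G : (t : ℕ) → ℕ × List (Literature.Computability.Cryptography.QCircuit Literature.Computability.Cryptography.cliffordT t × (ℤ × ℤ × ℤ × ℤ)), Literature.Computability.Complexity.PolyTimeComputable Computability.unaryEncodeNat (fun o : (Σ t : ℕ, ℕ × List (Literature.Computability.Cryptography.QCircuit Literature.Computability.Cryptography.cliffordT t × (ℤ × ℤ × ℤ × ℤ))) => Literature.Computability.Complexity.boolPair (Computability.encodeNat o.1) (Literature.Computability.Complexity.boolPair (Computability.encodeNat o.2.1) ((o.2.2.map fun x => Literature.Computability.Complexity.boolPair x.1.encode (Literature.Computability.Complexity.boolPair (Literature.Computability.Complexity.encodingIntBool.encode x.2.1) (Literature.Computability.Complexity.boolPair (Literature.Computability.Complexity.encodingIntBool.encode x.2.2.1) (Literature.Computability.Complexity.boolPair (Literature.Computability.Complexity.encodingIntBool.encode x.2.2.2.1)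 (Literature.Computability.Complexity.encodingIntBool.encode x.2.2.2.2))))).foldr Literature.Computability.Complexity.boolPair []))) (fun t => ⟨t, G t⟩) ∧ ∀ t : ℕ, (G t).2.length ≤ t ^ c + c ∧ (∀ x ∈ (G t).2, x.1.IsOracleFree ∧ x.1.tCount = 0) ∧ ∀ (R : Type) [CommRing R] (r : R), r ^ 4 = -1 → (2 : R) ^ (G t).1 • Literature.Computability.QuantumComplexity.magicVectorOver r t = ((G t).2.map fun x => ((x.2.1 : R) + (x.2.2.1 : R) * r + (x.2.2.2.1 : R) * r ^ 2 + (x.2.2.2.2 : R) * r ^ 3) • (Literature.Computability.QuantumComplexity.modGateEval r x.1).mulVec (Pi.single (fun _ => false) 1 : Literature.Computability.Cryptography.QReg t → R)).sum := by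
  sorry

/-- **stub 2 (effective reduction mod p with root finding; TRUE, M)**: from a uniform integral
identity, a per-prime decomposer valid at EVERY prime `p ≡ 1 (mod 8)`, poly-time on unary `(t,p)`:
least `r < p` with `r⁴ = −1` (exists: `(ZMod p)ˣ` is cyclic of order `p − 1 ≡ 0 (mod 8)`), the
coefficients `aᵢ(r) · (2⁻¹)^m` in `ZMod p` (`p` odd), same circuits; the identity is the universal
one at `R = ZMod p`. [cite: GilesSelinger2013, §3.2 Def. 3] [cite: AroraBarak2009, §1.2–1.3] -/
theorem stub_reduceModP :
    ∀ (c : ℕ) (G : (t : ℕ) → ℕ × List (Literature.Computability.Cryptography.QCircuit Literature.Computability.Cryptography.cliffordT t × (ℤ × ℤ × ℤ × ℤ))), (Literature.Computability.Complexity.PolyTimeComputable Computability.unaryEncodeNat (fun o : (Σ t : ℕ, ℕ × List (Literature.Computability.Cryptography.QCircuit Literature.Computability.Cryptography.cliffordT t × (ℤ × ℤ × ℤ × ℤ))) => Literature.Computability.Complexity.boolPair (Computability.encodeNat o.1) (Literature.Computability.Complexity.boolPair (Computability.encodeNat o.2.1) ((o.2.2.map fun x => Literature.Computability.Complexity.boolPair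 x.1.encode (Literature.Computability.Complexity.boolPair (Literature.Computability.Complexity.encodingIntBool.encode x.2.1) (Literature.Computability.Complexity.boolPair (Literature.Computability.Complexity.encodingIntBool.encode x.2.2.1) (Literature.Computability.Complexity.boolPair (Literature.Computability.Complexity.encodingIntBool.encode x.2.2.2.1) (Literature.Computability.Complexity.encodingIntBool.encode x.2.2.2.2))))).foldr Literature.Computability.Complexity.boolPair []))) (fun t => ⟨t, G t⟩) ∧ ∀ t : ℕ, (G t).2.length ≤ t ^ c + c ∧ (∀ x ∈ (G t).2, x.1.IsOracleFree ∧ x.1.tCount = 0) ∧ ∀ (R : Type) [CommRing R] (r : R), r ^ 4 = -1 → (2 : R) ^ (G t).1 • Literature.Computability.QuantumComplexity.magicVectorOver r t = ((G t).2.map fun x => ((x.2.1 : R) + (x.2.2.1 : R) * r + (x.2.2.2.1 : R) * r ^ 2 + (x.2.2.2.2 : R) * r ^ 3) • (Literature.Computability.QuantumComplexity.modGateEval r x.1).mulVec (Pi.single (fun _ => false) 1 : Literature.Computability.Cryptography.QReg t → R)).sum) → ∃ F : (t : ℕ) → ℕ → ℕ × List (Literature.Computability.Cryptography.QCircuit Literature.Computability.Cryptography.cliffordT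 t × ℕ), Literature.Computability.Complexity.PolyTimeComputable (fun q : ℕ × ℕ => Literature.Computability.Complexity.boolPair (Computability.unaryEncodeNat q.1) (Computability.unaryEncodeNat q.2)) (fun o : (Σ t : ℕ, ℕ × List (Literature.Computability.Cryptography.QCircuit Literature.Computability.Cryptography.cliffordT t × ℕ)) => Literature.Computability.Complexity.boolPair (Computability.encodeNat o.1) (Literature.Computability.Complexity.boolPair (Computability.encodeNat o.2.1) ((o.2.2.map fun x => Literature.Computability.Complexity.boolPair x.1.encode (Computability.encodeNat x.2)).foldr Literature.Computability.Complexity.boolPair []))) (fun q => ⟨q.1, F q.1 q.2⟩) ∧ ∀ t p : ℕ, p.Prime → p % 8 = 1 → ((F t p).1 : ZMod p) ^ 4 = -1 ∧ (F t p).2.length ≤ t ^ c + c ∧ (∀ x ∈ (F t p).2, x.1.IsOracleFree ∧ x.1.tCount = 0) ∧ Literature.Computability.QuantumComplexity.magicVectorOver ((F t p).1 : ZMod p) t = ((F t p).2.map fun x => (x.2 : ZMod p) • (Literature.Computability.QuantumComplexity.modGateEval ((F t p).1 : ZMod p) x.1).mulVec (Pi.single (fun _ => false) 1 : Literature.Computability.Cryptography.QReg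 t → ZMod p)).sum := by
  sorry

/-- **stub 3 (primes ≡ 1 (mod 8) are polynomially dense; TRUE, not in Mathlib)**: for some `d`,
every interval `[0, (t+k)^d + d)` contains at least `k` primes `p ≡ 1 (mod 8)` (prime number
theorem for the progression `1 mod 8`, `π(x;8,1) ~ x/(4 log x)`; explicit versions in
Bennett–Martin–O'Bryant–Rechnitzer, Illinois J. Math. 62 (2018), arXiv:1802.00085; Mathlib has only
the qualitative `Nat.setOf_prime_and_eq_mod_infinite` / `Nat.exists_prime_gt_modEq_one`).
[cite: BennettMartinOBryantRechnitzer2018, Thm 1.1–1.3] -/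
theorem stub_primesOneModEightDense :
    ∃ d : ℕ, ∀ t k : ℕ, k ≤ ((List.range ((t + k) ^ d + d)).filter fun p => decide (p.Prime ∧ p % 8 = 1)).length := by
  sorry

/-! ## Name-keyed aliases of the stub statements (the hypotheses of `DenseModularDecomposer_of`) -/

namespace Registered

/-- Alias of stub 1's statement keyed by the registered stub name. -/
abbrev stub_uniformIntegralIdentity : Prop :=
  ∃ c : ℕ, ∃ G : (t : ℕ) → ℕ × List (Literature.Computability.Cryptography.QCircuit Literature.Computability.Cryptography.cliffordT t × (ℤ × ℤ × ℤ × ℤ)), Literature.Computability.Complexity.PolyTimeComputable Computability.unaryEncodeNat (fun o : (Σ t : ℕ, ℕ × List (Literature.Computability.Cryptography.QCircuit Literature.Computability.Cryptography.cliffordT t × (ℤ × ℤ × ℤ × ℤ))) => Literature.Computability.Complexity.boolPair (Computability.encodeNat o.1) (Literature.Computability.Complexity.boolPair (Computability.encodeNat o.2.1) ((o.2.2.map fun x => Literature.Computability.Complexity.boolPair x.1.encode (Literature.Computability.Complexity.boolPair (Literature.Computability.Complexity.encodingIntBool.encode x.2.1) (Literature.Computability.Complexity.boolPair (Literature.Computability.Complexity.encodingIntBool.encode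 x.2.2.1) (Literature.Computability.Complexity.boolPair (Literature.Computability.Complexity.encodingIntBool.encode x.2.2.2.1) (Literature.Computability.Complexity.encodingIntBool.encode x.2.2.2.2))))).foldr Literature.Computability.Complexity.boolPair []))) (fun t => ⟨t, G t⟩) ∧ ∀ t : ℕ, (G t).2.length ≤ t ^ c + c ∧ (∀ x ∈ (G t).2, x.1.IsOracleFree ∧ x.1.tCount = 0) ∧ ∀ (R : Type) [CommRing R] (r : R), r ^ 4 = -1 → (2 : R) ^ (G t).1 • Literature.Computability.QuantumComplexity.magicVectorOver r t = ((G t).2.map fun x => ((x.2.1 : R) + (x.2.2.1 : R) * r + (x.2.2.2.1 : R) * r ^ 2 + (x.2.2.2.2 : R) * r ^ 3) • (Literature.Computability.QuantumComplexity.modGateEval r x.1).mulVec (Pi.single (fun _ => false) 1 : Literature.Computability.Cryptography.QReg t → R)).sum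

/-- Alias of stub 2's statement keyed by the registered stub name. -/
abbrev stub_reduceModP : Prop :=
  ∀ (c : ℕ) (G : (t : ℕ) → ℕ × List (Literature.Computability.Cryptography.QCircuit Literature.Computability.Cryptography.cliffordT t × (ℤ × ℤ × ℤ × ℤ))), (Literature.Computability.Complexity.PolyTimeComputable Computability.unaryEncodeNat (fun o : (Σ t : ℕ, ℕ × List (Literature.Computability.Cryptography.QCircuit Literature.Computability.Cryptography.cliffordT t × (ℤ × ℤ × ℤ × ℤ))) => Literature.Computability.Complexity.boolPair (Computability.encodeNat o.1) (Literature.Computability.Complexity.boolPair (Computability.encodeNat o.2.1) ((o.2.2.map fun x => Literature.Computability.Complexity.boolPair x.1.encode (Literature.Computability.Complexity.boolPair (Literature.Computability.Complexity.encodingIntBool.encode x.2.1) (Literature.Computability.Complexity.boolPair (Literature.Computability.Complexity.encodingIntBool.encode x.2.2.1) (Literature.Computability.Complexity.boolPair (Literature.Computability.Complexity.encodingIntBool.encode x.2.2.2.1) (Literature.Computability.Complexity.encodingIntBool.encode x.2.2.2.2))))).foldr Literature.Computability.Complexity.boolPair []))) (fun t => ⟨t, G t⟩) ∧ ∀ t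 : ℕ, (G t).2.length ≤ t ^ c + c ∧ (∀ x ∈ (G t).2, x.1.IsOracleFree ∧ x.1.tCount = 0) ∧ ∀ (R : Type) [CommRing R] (r : R), r ^ 4 = -1 → (2 : R) ^ (G t).1 • Literature.Computability.QuantumComplexity.magicVectorOver r t = ((G t).2.map fun x => ((x.2.1 : R) + (x.2.2.1 : R) * r + (x.2.2.2.1 : R) * r ^ 2 + (x.2.2.2.2 : R) * r ^ 3) • (Literature.Computability.QuantumComplexity.modGateEval r x.1).mulVec (Pi.single (fun _ => false) 1 : Literature.Computability.Cryptography.QReg t → R)).sum) → ∃ F : (t : ℕ) → ℕ → ℕ × List (Literature.Computability.Cryptography.QCircuit Literature.Computability.Cryptography.cliffordT t × ℕ), Literature.Computability.Complexity.PolyTimeComputable (fun q : ℕ × ℕ => Literature.Computability.Complexity.boolPair (Computability.unaryEncodeNat q.1) (Computability.unaryEncodeNat q.2)) (fun o : (Σ t : ℕ, ℕ × List (Literature.Computability.Cryptography.QCircuit Literature.Computability.Cryptography.cliffordT t × ℕ)) => Literature.Computability.Complexity.boolPair (Computability.encodeNat o.1) (Literature.Computability.Complexity.boolPair (Computability.encodeNat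 o.2.1) ((o.2.2.map fun x => Literature.Computability.Complexity.boolPair x.1.encode (Computability.encodeNat x.2)).foldr Literature.Computability.Complexity.boolPair []))) (fun q => ⟨q.1, F q.1 q.2⟩) ∧ ∀ t p : ℕ, p.Prime → p % 8 = 1 → ((F t p).1 : ZMod p) ^ 4 = -1 ∧ (F t p).2.length ≤ t ^ c + c ∧ (∀ x ∈ (F t p).2, x.1.IsOracleFree ∧ x.1.tCount = 0) ∧ Literature.Computability.QuantumComplexity.magicVectorOver ((F t p).1 : ZMod p) t = ((F t p).2.map fun x => (x.2 : ZMod p) • (Literature.Computability.QuantumComplexity.modGateEval ((F t p).1 : ZMod p) x.1).mulVec (Pi.single (fun _ => false) 1 : Literature.Computability.Cryptography.QReg t → ZMod p)).sum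

/-- Alias of stub 3's statement keyed by the registered stub name. -/
abbrev stub_primesOneModEightDense : Prop :=
  ∃ d : ℕ, ∀ t k : ℕ, k ≤ ((List.range ((t + k) ^ d + d)).filter fun p => decide (p.Prime ∧ p % 8 = 1)).length

end Registered

/-! ## The composition (real proof) -/

/-- **The line closes the item**: universal identity ∧ reduction ∧ density ⇒ `DenseModularDecomposer`
(by name), with the trivial recogniser `P := fun _ _ => true`. -/
theorem DenseModularDecomposer_of
    (hU : Registered.stub_uniformIntegralIdentity) (hR : Registered.stub_reduceModP)
    (hD : Registered.stub_primesOneModEightDense) :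
    Summit.QuantumAdvantage.QuantumAdvantage.Theses.ModularRank.DenseModularDecomposer := by
  obtain ⟨c, G, hG⟩ := hU
  obtain ⟨F, hF, hspec⟩ := hR c G hG
  obtain ⟨d, hd⟩ := hD
  refine ⟨c, d, fun _ _ => true, F, ?_, ?_, ?_, ?_⟩
  · -- the constant recogniser is poly-time
    exact Literature.Computability.Complexity.PolyTimeComputable.const _ _ true
  · exact hF
  · -- density: the two filters agree pointwise
    intro t k
    refine (hd t k).trans (le_of_eq (congrArg List.length (List.filter_congr fun p _ => ?_)))
    rw [Bool.eq_iff_iff, decide_eq_true_iff, decide_eq_true_iff]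
    simp
  · intro t p hp hmod _
    exact hspec t p hp hmod

/-- The piece from the three stubs, by the composition (closed modulo the stub `sorry`s; this is the
theorem the skeleton registry keys on). -/
theorem denseModularDecomposer_holds_of_stubs :
    Summit.QuantumAdvantage.QuantumAdvantage.Theses.ModularRank.DenseModularDecomposer :=
  DenseModularDecomposer_of stub_uniformIntegralIdentity stub_reduceModP stub_primesOneModEightDense

end Summit.QuantumAdvantage.QuantumAdvantage.Cruxes.DenseModularDecomposer.UniversalIdentityReduction
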